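import Summits.BirchSwinnertonDyer.BirchSwinnertonDyer.Theorems.PrintCf2RubinValueTwoEllipticUnitsGlobalMeasure
import Literature.NumberTheory.EllipticCurves.ProfiniteGroupDistributionInduceFromSubgroupCoarsen
import Literature.NumberTheory.NumberFields.RayClassTowerGlobalUnitsNorm
import Literature.NumberTheory.GaloisRepresentations.LubinTateColemanRelativeBaseChangeTwo
import HarnessLib

/-!
# COARSENING de Shalit's measure family across two moduli `𝔣 ∣ 𝔣′` on `Γ_K`: `(id)_* i_{𝔣′}(b′) = i_𝔣(N_{𝔣′,𝔣} b′)` —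
# de Shalit III.1.2 (ii) left square for the one-`𝔓` family induced to `Γ_K`, with the local model read in two
# unramified coefficient fields `E ≤ E′` (functoriality of the Coleman series under base change)

Cell `bsd-print-cf2`, width seat `bsd-line-cf2-p1-w8` g10 (piece (3) «hcompat across moduli» of the measure side of de Shalit II.4 at
`p = 2`, cf2c-w4 g10 / -w8 g9 successor list); `--supports` the banked S3a item stmt-BirchSwinnertonDyer-24721 (helper, Theses-free).
THEOREMS ONLY; no named facts (the elliptic-unit specialisation, which is conditional on the de Shalit II.2 prints, is the next file).

PRINT (de Shalit III.1.2 Lemma (ii), p. 89): for `𝔣 ∣ 𝔤`, with `π_{𝔤,𝔣} : Λ(𝔤) → Λ(𝔣)` the restriction and `N_{𝔤,𝔣}` the norm from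
`K(𝔤𝔭^∞)` to `K(𝔣𝔭^∞)`, the square `π_{𝔤,𝔣} ∘ i(𝔤) = i(𝔣) ∘ N_{𝔤,𝔣}` commutes ("follows from the definitions"); II.4.14 Step 1 (p. 71):
this compatibility makes the measures `μ(𝔤𝔭̄^m)` glue.  THIS file proves it for the tree's `i = induceFrom` of the one-`𝔓` family
`localMeasureFamily ∘ ofGlobalUnits` (`…EllipticUnitsGlobalUnits`, `…GlobalMeasure`) on `Γ_K`, for two moduli `0 ≠ 𝔣′ ⊆ 𝔣` (`v ∤ 𝔣′`,
`w_𝔣 = 1`) whose local models SHARE the Lubin–Tate datum `π = u·2`, `ε`, `σ₀`, `θ`, `e₂` and differ only in the unramified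
coefficient field `E ≤ E′` (with compatible readings `j′ ∘ ι = j`) and the global witnesses `α, f` / `α′, f′`:

* §1 `localMeasureFamily_μ_proj_of_mem` — on a cell `g U_n` with `g ∈ U_0` the one-`𝔓` measure of `β` IS the `Θ`-read inverse Amice
  transform of `(δ_E g_β)~ ∘ ϑ` at the class of `κ_v(g)⁻¹ mod 2^{n+1}` (`induce` and `comap` unfolded on the identity component);
* §2 ★ `localMeasureFamily_μ_proj_baseChange_eq` — **the one-`𝔓` measure of `ιβ ∈ 𝒰(E′·K_π^∞)` for the modulus `𝔣′`, read on a cell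
  `g U′_n` (`g ∈ U′_0`), equals the one-`𝔓` measure of `β ∈ 𝒰(E·K_π^∞)` for the modulus `𝔣` on `g U_n`**: `(δ(ιβ))~ = ι((δβ)~)`
  (`relTildeSeries_baseChange`, cf2c-w7) so the two series coincide after `j′ ∘ ι = j`, and `κ′_v = κ_v` on `Gal(K̄/K(𝔣′))`
  (`rayAdicCharacter_eq_of_le`); `ofGlobalUnits_eq_baseChange_of_coe_val_eq` — global sequences with the same components have
  `𝔓`-components related by `baseChange`;
* §3 ★★ `pushforward_induceFrom_localMeasureFamily_μ_eq` — **`(id)_* i_{𝔣′}(b′) = i_𝔣(N_{𝔣′,𝔣} b′)` levelwise on `Γ_K`** for EVERY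
  global norm-coherent unit sequence `b′` of modulus `𝔣′` (`GroupDistribution.pushforward_induceFrom_μ_eq_induceFrom_of_norm` with the
  transversal of `RayClassFieldAdicTowerRefine.exists_rayTransversal` and `GlobalNormCoherentUnits.relNorm`).

What is NOT here: `N_{𝔣𝔩,𝔣} e_{𝔣𝔩}(𝔠) = e_𝔣(𝔠)` (II.2.5 (i), `𝔩 ∣ 𝔣`) and the resulting `hcompat` for the elliptic-unit measures
(next file), the glue itself (`exists_glue_twisting_μ_eq_forall_of_units`).  HONEST FRAMING: an assembly of accepted kernel theorems;
nothing here closes a crux; no summit statement is proved; BSD is not proved by any of this.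

## References
* [deShalit1987] E. de Shalit, *Iwasawa theory of elliptic curves with complex multiplication* (1987), III.1.2 Lemma (ii) (p. 89),
  II.4.12 (ii) (p. 67), II.4.14 Step 1 (p. 71), II.4.6 (14) (p. 59), I.3.4 (p. 18), I.3.3 (9) (p. 18).
-/

-- the summit namespace `Summit.BirchSwinnertonDyer.BirchSwinnertonDyer` repeats the problem name by design (D-0017)
set_option linter.dupNamespace false
set_option autoImplicit false

noncomputable section

open scoped Classical nonZeroDivisors
open scoped NumberField
open Field IsDedekindDomain IsDedekindDomain.HeightOneSpectrum ValuativeRel IsLocalRing MvPowerSeries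
open Literature.NumberTheory.NumberFields
open Literature.NumberTheory.GaloisRepresentations Literature.NumberTheory.GaloisRepresentations.IsNonarchimedeanLocalField
  Literature.NumberTheory.GaloisRepresentations.LubinTate Literature.NumberTheory.GaloisRepresentations.ArtinLocalGlobal
  Literature.NumberTheory.PAdicHodge
open Literature.NumberTheory.EllipticCurves Literature.NumberTheory.EllipticCurves.GroupDistribution
open Summit.BirchSwinnertonDyer.BirchSwinnertonDyer.Theorems.PrintCf2.EllipticUnitsLocal
open Summit.BirchSwinnertonDyer.BirchSwinnertonDyer.Theorems.PrintCf2.EllipticUnitsGlobal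

namespace Summit.BirchSwinnertonDyer.BirchSwinnertonDyer.Theorems.PrintCf2.EllipticUnitsGlobalCoarsen

variable {K : Type} [Field K] [NumberField K] {𝔣 𝔣' : Ideal (𝓞 K)} {v : HeightOneSpectrum (𝓞 K)}

attribute [local instance] GlobalNormCoherentUnits.instCommMonoid GlobalNormCoherentUnits.galAction
attribute [local instance] ltNormUniformSpace ltNormIsUniformAddGroup rk1 nF nE fintypeResidueField
attribute [local instance] RelNormCoherentUnits.instCommMonoid

variable [NumberField.IsTotallyComplex K]
  -- the common local datum at `v`: `π = u·2`, `σ₀`, `ε`, `θ`, `e₂`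
  (hq : residueFieldCard (v.adicCompletion K) = 2)
  (h2 : (valuation (v.adicCompletion K)).IsUniformizer ((((2 : ℕ) : 𝒪[v.adicCompletion K]) : v.adicCompletion K)))
  (u : 𝒪[v.adicCompletion K]ˣ)
  {σ₀ : absoluteGaloisGroup (v.adicCompletion K)} (hσ₀ : IsAbsArithFrob σ₀)
  {ε : (maxUnramifiedCompletion (v.adicCompletion K))ˣ}
  (hε : maxUnramifiedCompletion.galAut (v.adicCompletion K) σ₀ (ε : maxUnramifiedCompletion (v.adicCompletion K)) =
    algebraMap 𝒪[v.adicCompletion K] (maxUnramifiedCompletion (v.adicCompletion K)) (u : 𝒪[v.adicCompletion K]) *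
      (ε : maxUnramifiedCompletion (v.adicCompletion K)))
  (θ : CompletedAlgClosure (v.adicCompletion K) →+* ℂ_[2])
  (hθ1 : ∀ z : CBall (v.adicCompletion K), ‖θ (z : CompletedAlgClosure (v.adicCompletion K))‖ ≤ 1)
  (e₂ : v.adicCompletionIntegers K ≃+* ℤ_[2])
  (hΘe : ∀ a : 𝒪[v.adicCompletion K], (θ.comp ((CBall (v.adicCompletion K)).subtype.comp
      (algebraMap (UnrCoeff (v.adicCompletion K)) (CBall (v.adicCompletion K))))) (intToUnrCoeff (v.adicCompletion K) a) =
    padicIntCast ℂ_[2] (((e₂ : v.adicCompletionIntegers K →+* ℤ_[2]).comp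
      (integerEquivAdicCompletionIntegers v).toRingHom) a))
  -- the modulus `𝔣` with its unramified coefficient field `E`, global witness `α`, reading `j`, cell maps `ψ`
  (h𝔣0 : 𝔣 ≠ ⊥) (hv : ¬ 𝔣 ≤ v.asIdeal) (hw : ∀ u : (𝓞 K)ˣ, (u : 𝓞 K) - 1 ∈ 𝔣 → u = 1)
  {α : 𝓞 K} (hα0 : α ≠ 0) (hα𝔣 : α - 1 ∈ 𝔣) (hαw : ∀ w : HeightOneSpectrum (𝓞 K), w ≠ v → α ∉ w.asIdeal)
  {f : ℕ} (hαπ : ((α : K) : v.adicCompletion K) =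
    ((((u : 𝒪[v.adicCompletion K]) * ((2 : ℕ) : 𝒪[v.adicCompletion K]) : 𝒪[v.adicCompletion K]) : v.adicCompletion K)) ^ f)
  (E : IntermediateField (v.adicCompletion K) (AlgebraicClosure (v.adicCompletion K)))
  [FiniteDimensional (v.adicCompletion K) E] [IsGalois (v.adicCompletion K) E] (hE : E ≤ maxUnramified (v.adicCompletion K))
  (hdegE : ∀ w : WeilGroup (v.adicCompletion K),
    WeilGroup.toAbsGalois (v.adicCompletion K) w ∈ E.fixingSubgroup → (f : ℤ) ∣ WeilGroup.deg w)
  (j : unitBall E →+* UnrCoeff (v.adicCompletion K))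
  (hj : j.comp (algebraMap (LTCoeff (v.adicCompletion K)) (unitBall E)) =
    (intToUnrCoeff (v.adicCompletion K)).comp (LTCoeff.of (v.adicCompletion K)).symm.toRingHom)
  (hjC : (algebraMap (UnrCoeff (v.adicCompletion K)) (CBall (v.adicCompletion K))).comp j = unitBallToCBall E)
  (ψ : (n : ℕ) → ↥(absRestrictNormalHom (rayClassField K 𝔣)).ker ⧸ (rayAdicTower (𝔪 := 𝔣) h𝔣0 v).U n → ZMod (2 ^ (n + 1)))
  (hψ : ∀ (n : ℕ) (g : ↥(absRestrictNormalHom (rayClassField K 𝔣)).ker), g ∈ (rayAdicTower (𝔪 := 𝔣) h𝔣0 v).U 0 →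
    ψ n ((rayAdicTower (𝔪 := 𝔣) h𝔣0 v).proj n g) =
      PadicInt.toZModPow (n + 1) ((((Units.map (e₂ : v.adicCompletionIntegers K →+* ℤ_[2]).toMonoidHom).comp
        (rayAdicCharacter h𝔣0 hv hw))⁻¹ g : ℤ_[2]ˣ) : ℤ_[2]))
  -- the modulus `𝔣′ ⊆ 𝔣` with `E′ ⊇ E`, `α′`, `j′`, `ψ′`
  (h𝔣'0 : 𝔣' ≠ ⊥) (hv' : ¬ 𝔣' ≤ v.asIdeal) (hw' : ∀ u : (𝓞 K)ˣ, (u : 𝓞 K) - 1 ∈ 𝔣' → u = 1)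
  {α' : 𝓞 K} (hα'0 : α' ≠ 0) (hα'𝔣 : α' - 1 ∈ 𝔣') (hα'w : ∀ w : HeightOneSpectrum (𝓞 K), w ≠ v → α' ∉ w.asIdeal)
  {f' : ℕ} (hα'π : ((α' : K) : v.adicCompletion K) =
    ((((u : 𝒪[v.adicCompletion K]) * ((2 : ℕ) : 𝒪[v.adicCompletion K]) : 𝒪[v.adicCompletion K]) : v.adicCompletion K)) ^ f')
  (E' : IntermediateField (v.adicCompletion K) (AlgebraicClosure (v.adicCompletion K)))
  [FiniteDimensional (v.adicCompletion K) E'] [IsGalois (v.adicCompletion K) E'] (hE' : E' ≤ maxUnramified (v.adicCompletion K))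
  (hdegE' : ∀ w : WeilGroup (v.adicCompletion K),
    WeilGroup.toAbsGalois (v.adicCompletion K) w ∈ E'.fixingSubgroup → (f' : ℤ) ∣ WeilGroup.deg w)
  (j' : unitBall E' →+* UnrCoeff (v.adicCompletion K))
  (hj' : j'.comp (algebraMap (LTCoeff (v.adicCompletion K)) (unitBall E')) =
    (intToUnrCoeff (v.adicCompletion K)).comp (LTCoeff.of (v.adicCompletion K)).symm.toRingHom)
  (hjC' : (algebraMap (UnrCoeff (v.adicCompletion K)) (CBall (v.adicCompletion K))).comp j' = unitBallToCBall E')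
  (ψ' : (n : ℕ) → ↥(absRestrictNormalHom (rayClassField K 𝔣')).ker ⧸ (rayAdicTower (𝔪 := 𝔣') h𝔣'0 v).U n → ZMod (2 ^ (n + 1)))
  (hψ' : ∀ (n : ℕ) (g : ↥(absRestrictNormalHom (rayClassField K 𝔣')).ker), g ∈ (rayAdicTower (𝔪 := 𝔣') h𝔣'0 v).U 0 →
    ψ' n ((rayAdicTower (𝔪 := 𝔣') h𝔣'0 v).proj n g) =
      PadicInt.toZModPow (n + 1) ((((Units.map (e₂ : v.adicCompletionIntegers K →+* ℤ_[2]).toMonoidHom).comp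
        (rayAdicCharacter h𝔣'0 hv' hw'))⁻¹ g : ℤ_[2]ˣ) : ℤ_[2]))
  -- the links
  (hle : 𝔣' ≤ 𝔣) (hEE' : E ≤ E')
  (hjj' : j'.comp (inclUnitBall (F := v.adicCompletion K) hEE' : unitBall E →+* unitBall E') = j)
  [hN : ∀ n, ((rayAdicTower (𝔪 := 𝔣) h𝔣0 v).U n).Normal] [hN' : ∀ n, ((rayAdicTower (𝔪 := 𝔣') h𝔣'0 v).U n).Normal]

/-! ## §1. The one-`𝔓` measure on the cells of the identity component -/

/-- Generalisation bookkeeping: the restricted `x⁻¹`-density of the inverse Amice transform depends only on the power series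
(not on the coefficient-bound witness). [cite: deShalit1987, I.3.3 (8) (p. 17)] -/
theorem restrictUnits_density_invAmice₁_congr {S S' : PowerSeries ℂ_[2]} (hSS' : S = S')
    (hS : ∀ k, ‖PowerSeries.coeff k S‖ ≤ (1 : ℝ)) (hS' : ∀ k, ‖PowerSeries.coeff k S'‖ ≤ (1 : ℝ)) (n : ℕ)
    (c : ((ProfiniteTower.padicInt 2).succ).Cell n) :
    (restrictUnits ((invAmice₁ 2 S hS).density (ProfiniteTower.padicInt_isUniform 2) (unitInv ℂ_[2]) uniformContinuous_unitInv
      norm_unitInv_le)).μ n c =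
    (restrictUnits ((invAmice₁ 2 S' hS').density (ProfiniteTower.padicInt_isUniform 2) (unitInv ℂ_[2]) uniformContinuous_unitInv
      norm_unitInv_le)).μ n c := by
  subst hSS'
  rfl

set_option maxHeartbeats 800000 in
include hj hΘe in
/-- **The one-`𝔓` measure on a cell `g U_n` of the identity component** (`g ∈ U_0 = Gal(K̄/K(𝔣v))`): `i_𝔓(β)_n(g U_n)` is the value of the
`x⁻¹`-density of the inverse Amice transform of `Θ(j((δ_E g_β)~) ∘ ϑ)` at the cell `ψ_n(g U_n) = κ_v(g)⁻¹ mod 2^{n+1}` (`induce` reads the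
family itself on `U_0`, `comap` reads the pulled-back measure). [cite: deShalit1987, II.4.6 (13)–(14) (p. 59), I.3.3 (9) (p. 18), I.3.4 (p. 18)] -/
theorem localMeasureFamily_μ_proj_of_mem (β : RelNormCoherentUnits (isUniformizer_unit_mul h2 u) E) (n : ℕ)
    (g : ↥(absRestrictNormalHom (rayClassField K 𝔣)).ker) (hg : g ∈ (rayAdicTower (𝔪 := 𝔣) h𝔣0 v).U 0) :
    (localMeasureFamily h𝔣0 hv hw hq h2 u E hE hσ₀ hε θ hθ1 j hjC e₂ ψ hψ β).μ n ((rayAdicTower (𝔪 := 𝔣) h𝔣0 v).proj n g) =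
      (restrictUnits ((invAmice₁ 2 ((PowerSeries.subst (compSeriesC h2 hσ₀ u hε)
        ((relTildeSeries (isUniformizer_unit_mul h2 u) E hq hE hσ₀
          (LTCoeff.of (v.adicCompletion K) (u : 𝒪[v.adicCompletion K])) β).map j)).map
        (θ.comp ((CBall (v.adicCompletion K)).subtype.comp
          (algebraMap (UnrCoeff (v.adicCompletion K)) (CBall (v.adicCompletion K))))))
        (norm_coeff_relSeries_le_one hq h2 u E hE hσ₀ hε θ hθ1 j hjC β)).density
        (ProfiniteTower.padicInt_isUniform 2) (unitInv ℂ_[2]) uniformContinuous_unitInv norm_unitInv_le)).μ n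
        (ψ n ((rayAdicTower (𝔪 := 𝔣) h𝔣0 v).proj n g)) := by
  letI := rayAction h𝔣0 hv hw (isUniformizer_unit_mul h2 u) E hE
  have ha : (rayAdicTower (𝔪 := 𝔣) h𝔣0 v).transLE (Nat.zero_le n) ((rayAdicTower (𝔪 := 𝔣) h𝔣0 v).proj n g) = 1 := by
    rw [SubgroupTower.transLE_proj]
    exact (QuotientGroup.eq_one_iff _).mpr hg
  have h1 := induce_μ_of_transLE_eq_one_seriesFamily (hq := hq) (h2 := h2) (hσ₀ := hσ₀) (u := u) (hε := hε)
    (Θ := θ.comp ((CBall (v.adicCompletion K)).subtype.comp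
      (algebraMap (UnrCoeff (v.adicCompletion K)) (CBall (v.adicCompletion K)))))
    (e := (e₂ : v.adicCompletionIntegers K →+* ℤ_[2]).comp (integerEquivAdicCompletionIntegers v).toRingHom) (hΘe := hΘe)
    (κ := ((Units.map (e₂ : v.adicCompletionIntegers K →+* ℤ_[2]).toMonoidHom).comp (rayAdicCharacter h𝔣0 hv hw))⁻¹)
    (hU := mem_rayAdicTower_iff_inv h𝔣0 h𝔣0 hv hw e₂ le_rfl hv)
    (hκ := exists_toZModPow_padicRayAdicCharacter_inv_eq h𝔣0 h𝔣0 hv hw e₂ le_rfl hv) (ψ := ψ) (hψ := hψ)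
    (φ := fun β : RelNormCoherentUnits (isUniformizer_unit_mul h2 u) E ↦
      (relTildeSeries (isUniformizer_unit_mul h2 u) E hq hE hσ₀ (LTCoeff.of (v.adicCompletion K) (u : 𝒪[v.adicCompletion K])) β).map j)
    (hgal := seriesFamily_hgal_rayAction (h𝔪 := h𝔣0) (hv := hv) (hw := hw) (h2 := h2) (u := u) (E := E) (hE := hE) (hq := hq)
      (hσ₀ := hσ₀) (uL := LTCoeff.of (v.adicCompletion K) (u : 𝒪[v.adicCompletion K])) (j := j) (hj := hj)
      (e := (e₂ : v.adicCompletionIntegers K →+* ℤ_[2]).comp (integerEquivAdicCompletionIntegers v).toRingHom)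
      (𝒰 := rayAdicTower (𝔪 := 𝔣) h𝔣0 v)
      (κ := (((Units.map (e₂ : v.adicCompletionIntegers K →+* ℤ_[2]).toMonoidHom).comp (rayAdicCharacter h𝔣0 hv hw))⁻¹))
      (hκ := padicRayAdicCharacter_inv_apply h𝔣0 hv hw e₂))
    (hC := norm_coeff_relSeries_le_one hq h2 u E hE hσ₀ hε θ hθ1 j hjC) (hC0 := zero_le_one) (hCb := fun _ ↦ le_rfl) β n _ ha
  rw [comap_μ_of_transLE_eq_one _ _ _ _ _ n _ ha] at h1
  exact h1

/-! ## §2. Base change of the coefficient field and change of modulus on the identity component -/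

include h𝔣'0 hle in
omit [NumberField.IsTotallyComplex K] hN hN' in
/-- `Gal(K̄/K(𝔣′)) ≤ Gal(K̄/K(𝔣))` (unfolded). [cite: NeukirchANT1999, Ch. VI §6 Def. (6.2)] -/
theorem mem_ker_of_mem_ker' {g : absoluteGaloisGroup K} (hg : g ∈ (absRestrictNormalHom (rayClassField K 𝔣')).ker) :
    g ∈ (absRestrictNormalHom (rayClassField K 𝔣)).ker :=
  ker_absRestrictNormalHom_rayClassField_anti h𝔣'0 hle hg

omit [NumberField.IsTotallyComplex K] hN hN' in
/-- `U′_0 ≤ U_0`, read in the relative towers: `g ∈ Gal(K̄/K(𝔣′v))` gives `g ∈ Gal(K̄/K(𝔣v))`. [cite: deShalit1987, II.4.14 Step 1 (p. 71)] -/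
theorem mem_rayAdicTower_U_zero_of_mem {g : absoluteGaloisGroup K} (hgH' : g ∈ (absRestrictNormalHom (rayClassField K 𝔣')).ker)
    (hg : (⟨g, hgH'⟩ : ↥(absRestrictNormalHom (rayClassField K 𝔣')).ker) ∈ (rayAdicTower (𝔪 := 𝔣') h𝔣'0 v).U 0) :
    (⟨g, mem_ker_of_mem_ker' h𝔣'0 hle hgH'⟩ : ↥(absRestrictNormalHom (rayClassField K 𝔣)).ker) ∈
      (rayAdicTower (𝔪 := 𝔣) h𝔣0 v).U 0 := by
  rw [mem_rayAdicTower_U_iff] at hg ⊢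
  exact absRayAdicTower_U_anti h𝔣0 h𝔣'0 v hle 0 hg

set_option maxHeartbeats 1600000 in
include hj hj' hΘe hle hjj' in
/-- ★ **The one-`𝔓` measure of `ιβ` for `𝔣′` on `g U′_n` equals the one-`𝔓` measure of `β` for `𝔣` on `g U_n`** (`g ∈ U′_0`): the two
`Θ`-read series coincide — `(δ_{E′} g_{ιβ})~ = ι((δ_E g_β)~)` (`relTildeSeries_baseChange`) and `j′ ∘ ι = j` — and the two cells have the
same index `κ′_v(g)⁻¹ = κ_v(g)⁻¹ mod 2^{n+1}` (`rayAdicCharacter_eq_of_le`).  This is the functoriality of de Shalit's `i` in the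
coefficient field (III.1.2 (i): "`i` is canonically associated to the extension") on the identity component.
[cite: deShalit1987, III.1.2 Lemma (i)–(ii) (p. 89), II.4.6 (14) (p. 59), I.3.3 (9) (p. 18)] -/
theorem localMeasureFamily_μ_proj_baseChange_eq (β : RelNormCoherentUnits (isUniformizer_unit_mul h2 u) E) (n : ℕ)
    (g : absoluteGaloisGroup K) (hgH' : g ∈ (absRestrictNormalHom (rayClassField K 𝔣')).ker)
    (hg : (⟨g, hgH'⟩ : ↥(absRestrictNormalHom (rayClassField K 𝔣')).ker) ∈ (rayAdicTower (𝔪 := 𝔣') h𝔣'0 v).U 0) :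
    (localMeasureFamily h𝔣'0 hv' hw' hq h2 u E' hE' hσ₀ hε θ hθ1 j' hjC' e₂ ψ' hψ'
        (β.baseChange (isUniformizer_unit_mul h2 u) hq hEE' hE' hσ₀)).μ n
        ((rayAdicTower (𝔪 := 𝔣') h𝔣'0 v).proj n ⟨g, hgH'⟩) =
      (localMeasureFamily h𝔣0 hv hw hq h2 u E hE hσ₀ hε θ hθ1 j hjC e₂ ψ hψ β).μ n
        ((rayAdicTower (𝔪 := 𝔣) h𝔣0 v).proj n ⟨g, mem_ker_of_mem_ker' h𝔣'0 hle hgH'⟩) := by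
  rw [localMeasureFamily_μ_proj_of_mem hq h2 u hσ₀ hε θ hθ1 e₂ hΘe h𝔣'0 hv' hw' E' hE' j' hj' hjC' ψ' hψ' _ n _ hg,
    localMeasureFamily_μ_proj_of_mem hq h2 u hσ₀ hε θ hθ1 e₂ hΘe h𝔣0 hv hw E hE j hj hjC ψ hψ β n _
      (mem_rayAdicTower_U_zero_of_mem h𝔣0 h𝔣'0 hle hgH' hg),
    hψ' n _ hg, hψ n _ (mem_rayAdicTower_U_zero_of_mem h𝔣0 h𝔣'0 hle hgH' hg)]
  -- the cell indices agree: `κ′_v(g) = κ_v(g)`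
  have hκ : rayAdicCharacter h𝔣'0 hv' hw' ⟨g, hgH'⟩ =
      rayAdicCharacter h𝔣0 hv hw ⟨g, mem_ker_of_mem_ker' h𝔣'0 hle hgH'⟩ :=
    (rayAdicCharacter_eq_of_le h𝔣0 hv hw h𝔣'0 hle hv' hw' ⟨g, hgH'⟩).symm
  have hcell : ((((Units.map (e₂ : v.adicCompletionIntegers K →+* ℤ_[2]).toMonoidHom).comp
        (rayAdicCharacter h𝔣'0 hv' hw'))⁻¹ ⟨g, hgH'⟩ : ℤ_[2]ˣ) : ℤ_[2]) =
      ((((Units.map (e₂ : v.adicCompletionIntegers K →+* ℤ_[2]).toMonoidHom).comp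
        (rayAdicCharacter h𝔣0 hv hw))⁻¹ ⟨g, mem_ker_of_mem_ker' h𝔣'0 hle hgH'⟩ : ℤ_[2]ˣ) : ℤ_[2]) := by
    rw [MonoidHom.inv_apply, MonoidHom.inv_apply, MonoidHom.comp_apply, MonoidHom.comp_apply, hκ]
  rw [hcell]
  -- the series agree: `(δ(ιβ))~ = ι((δβ)~)` and `j′ ∘ ι = j`
  refine restrictUnits_density_invAmice₁_congr ?_ _ _ n _
  rw [relTildeSeries_baseChange, ← RingHom.comp_apply (PowerSeries.map j')
    (PowerSeries.map (inclUnitBall (F := v.adicCompletion K) hEE' : unitBall E →+* unitBall E')), ← PowerSeries.map_comp, hjj']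

omit hN hN' in
/-- **Global sequences with the same components have `𝔓`-components related by base change**: if `c′` (modulus `𝔣′`) and `c`
(modulus `𝔣`) have the same components in `K̄`, then `(c′)_𝔓 ∈ 𝒰(E′·K_π^∞)` is `ι((c)_𝔓)` for `(c)_𝔓 ∈ 𝒰(E·K_π^∞)`
(both have components `ι_v(c_m)`; `coe_val_baseChange`). [cite: deShalit1987, II.4.9 (24) (p. 62), III.1.3] -/
theorem ofGlobalUnits_eq_baseChange_of_coe_val_eq (c' : GlobalNormCoherentUnits h𝔣'0 v) (c : GlobalNormCoherentUnits h𝔣0 v)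
    (hcc' : ∀ m, ((c'.val m : rayClassField K (𝔣' * v.asIdeal ^ (m + 1))) : AlgebraicClosure K) =
      ((c.val m : rayClassField K (𝔣 * v.asIdeal ^ (m + 1))) : AlgebraicClosure K)) :
    RelNormCoherentUnits.ofGlobalUnits h𝔣'0 hv' hw' (isUniformizer_unit_mul h2 u) hα'0 hα'𝔣 hα'w hα'π E' hE' hdegE' c' =
      (RelNormCoherentUnits.ofGlobalUnits h𝔣0 hv hw (isUniformizer_unit_mul h2 u) hα0 hα𝔣 hαw hαπ E hE hdegE c).baseChange
        (isUniformizer_unit_mul h2 u) hq hEE' hE' hσ₀ := by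
  refine RelNormCoherentUnits.ext fun m ↦ Subtype.ext (Subtype.ext ?_)
  rw [coe_val_ofGlobalUnits, RelNormCoherentUnits.coe_val_baseChange, IntermediateField.coe_inclusion, coe_val_ofGlobalUnits, hcc' m]

/-! ## §3. `(id)_* i_{𝔣′}(b′) = i_𝔣(N_{𝔣′,𝔣} b′)` on `Γ_K` -/

variable [hNabs : ∀ n, ((absRayAdicTower (𝔪' := 𝔣) h𝔣0 v).U n).Normal]
  [hNabs' : ∀ n, ((absRayAdicTower (𝔪' := 𝔣') h𝔣'0 v).U n).Normal]

set_option maxHeartbeats 1600000 in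
include hj hj' hΘe hjj' hv' in
/-- ★★ **COARSENING ACROSS THE MODULI: `(id)_* i_{𝔣′}(b′) = i_𝔣(N_{𝔣′,𝔣} b′)` levelwise on `Γ_K`** (de Shalit III.1.2 (ii) left square,
`π_{𝔤,𝔣} ∘ i(𝔤) = i(𝔣) ∘ N_{𝔤,𝔣}`, for the tree's `i = induceFrom` of the one-`𝔓` family `localMeasureFamily ∘ ofGlobalUnits`): for EVERY
global norm-coherent unit sequence `b′` of modulus `𝔣′` (`0 ≠ 𝔣′ ⊆ 𝔣`, `v ∤ 𝔣′`, `w_𝔣 = 1`), the measure `i_{𝔣′}(b′)` on `Γ_K` along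
`Gal(K̄/K(𝔣′v^{n+1}))`, pushed forward to the coarser tower `Gal(K̄/K(𝔣v^{n+1}))`, IS `i_𝔣(N_{𝔣′,𝔣} b′)` — the two local models sharing
`π = u·2, ε, σ₀, θ, e₂`, with coefficient fields `E ≤ E′` and `j′ ∘ ι = j`.  Assembled from `GroupDistribution.pushforward_induceFrom_μ_eq_induceFrom_of_norm`
with the transversal `T ⊆ Gal(K̄/K(𝔣v^∞))` of `Gal(K(𝔣′)/K(𝔣))` (`exists_rayTransversal`), `N = GlobalNormCoherentUnits.relNorm`
(`∏_{τ∈T} τ•b′` has the components of `N b′`), and §2 on the identity component.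
[cite: deShalit1987, III.1.2 Lemma (ii) (p. 89), II.4.12 (ii) (p. 67), II.4.14 Step 1 (p. 71), II.4.6 (14) (p. 59)] -/
theorem pushforward_induceFrom_localMeasureFamily_μ_eq (b' : GlobalNormCoherentUnits h𝔣'0 v) (n : ℕ)
    (a : absoluteGaloisGroup K ⧸ (absRayAdicTower (𝔪' := 𝔣) h𝔣0 v).U n) :
    ((GroupDistribution.induceFrom (Γ := absoluteGaloisGroup K) (fun n ↦ rayAdicTower_U_eq_subgroupOf (𝔪 := 𝔣') h𝔣'0 v n)
        (fun b : GlobalNormCoherentUnits h𝔣'0 v ↦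
          localMeasureFamily h𝔣'0 hv' hw' hq h2 u E' hE' hσ₀ hε θ hθ1 j' hjC' e₂ ψ' hψ'
            (RelNormCoherentUnits.ofGlobalUnits h𝔣'0 hv' hw' (isUniformizer_unit_mul h2 u) hα'0 hα'𝔣 hα'w hα'π E' hE' hdegE' b))
        zero_le_one (fun _ ↦ le_rfl) b').pushforward (MonoidHom.id (absoluteGaloisGroup K))
        (absRayAdicTower_le_comap_id h𝔣0 h𝔣'0 v hle)).μ n a =
      (GroupDistribution.induceFrom (Γ := absoluteGaloisGroup K) (fun n ↦ rayAdicTower_U_eq_subgroupOf (𝔪 := 𝔣) h𝔣0 v n)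
        (fun b : GlobalNormCoherentUnits h𝔣0 v ↦
          localMeasureFamily h𝔣0 hv hw hq h2 u E hE hσ₀ hε θ hθ1 j hjC e₂ ψ hψ
            (RelNormCoherentUnits.ofGlobalUnits h𝔣0 hv hw (isUniformizer_unit_mul h2 u) hα0 hα𝔣 hαw hαπ E hE hdegE b))
        zero_le_one (fun _ ↦ le_rfl) (GlobalNormCoherentUnits.relNorm h𝔣0 h𝔣'0 hle b')).μ n a := by
  obtain ⟨T, hT, hcov, hinj, hne⟩ := exists_rayTransversal h𝔣0 h𝔣'0 v hle hv' hw
  refine pushforward_induceFrom_μ_eq_induceFrom_of_norm (Γ := absoluteGaloisGroup K)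
    (H' := (absRestrictNormalHom (rayClassField K 𝔣')).ker) (H := (absRestrictNormalHom (rayClassField K 𝔣)).ker)
    (𝒰' := absRayAdicTower (𝔪' := 𝔣') h𝔣'0 v) (𝒰 := absRayAdicTower (𝔪' := 𝔣) h𝔣0 v)
    (𝒱' := rayAdicTower (𝔪 := 𝔣') h𝔣'0 v) (𝒱 := rayAdicTower (𝔪 := 𝔣) h𝔣0 v)
    (fun n ↦ rayAdicTower_U_eq_subgroupOf (𝔪 := 𝔣') h𝔣'0 v n) (fun n ↦ rayAdicTower_U_eq_subgroupOf (𝔪 := 𝔣) h𝔣0 v n)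
    (absRayAdicTower_le_comap_id h𝔣0 h𝔣'0 v hle) _ zero_le_one (fun _ ↦ le_rfl) ?_ (absRayAdicTower_U_le_ker h𝔣'0 v le_rfl 0) ?_
    _ zero_le_one (fun _ ↦ le_rfl) (absRayAdicTower_U_le_ker h𝔣0 v le_rfl 0) ?_
    (GlobalNormCoherentUnits.relNorm h𝔣0 h𝔣'0 hle) T hT
    (card_filter_homCellMap_eq_card_rayTransversal h𝔣0 h𝔣'0 v hle hv' hw hT hcov hinj) (Finset.card_ne_zero.mpr hne) ?_ b' n a
  · -- additivity of the fine family
    exact fun b b'' k c ↦ globalMeasureFamily_μ_mul h𝔣'0 hv' hw' hq h2 u hα'0 hα'𝔣 hα'w hα'π E' hE' hdegE' hσ₀ hε θ hθ1 j' hjC' e₂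
      ψ' hψ' b b'' k c
  · -- `H'`-equivariance of the fine family
    exact fun h b k c ↦ globalMeasureFamily_μ_smul h𝔣'0 hv' hw' hq h2 u hα'0 hα'𝔣 hα'w hα'π E' hE' hdegE' hσ₀ hε θ hθ1 j' hj' hjC'
      e₂ hΘe ψ' hψ' h b k c
  · -- `H`-equivariance of the coarse family
    exact fun h b k c ↦ globalMeasureFamily_μ_smul h𝔣0 hv hw hq h2 u hα0 hα𝔣 hαw hαπ E hE hdegE hσ₀ hε θ hθ1 j hj hjC e₂ hΘe
      ψ hψ h b k c
  · -- the local comparison on the identity component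
    intro γ b'' k g hg
    have hgH' : g ∈ (absRestrictNormalHom (rayClassField K 𝔣')).ker := absRayAdicTower_U_le_ker h𝔣'0 v le_rfl 0 hg
    have hg' : (⟨g, hgH'⟩ : ↥(absRestrictNormalHom (rayClassField K 𝔣')).ker) ∈ (rayAdicTower (𝔪 := 𝔣') h𝔣'0 v).U 0 :=
      (mem_rayAdicTower_U_iff h𝔣'0 v 0 _).mpr hg
    have hbc := ofGlobalUnits_eq_baseChange_of_coe_val_eq hq h2 u hσ₀ h𝔣0 hv hw hα0 hα𝔣 hαw hαπ E hE hdegE h𝔣'0 hv' hw' hα'0 hα'𝔣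
      hα'w hα'π E' hE' hdegE' hEE' (γ • ∏ τ ∈ T, τ • b'') (γ • GlobalNormCoherentUnits.relNorm h𝔣0 h𝔣'0 hle b'')
      (fun m ↦ GlobalNormCoherentUnits.coe_val_smul_finset_prod_smul_eq h𝔣0 h𝔣'0 hle hv' hw hT hcov hinj γ b'' m)
    rw [hbc]
    exact localMeasureFamily_μ_proj_baseChange_eq hq h2 u hσ₀ hε θ hθ1 e₂ hΘe h𝔣0 hv hw E hE j hj hjC ψ hψ h𝔣'0 hv' hw' E' hE'
      j' hj' hjC' ψ' hψ' hle hEE' hjj' _ k g hgH' hg'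

end Summit.BirchSwinnertonDyer.BirchSwinnertonDyer.Theorems.PrintCf2.EllipticUnitsGlobalCoarsen

end
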